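import Summits.BirchSwinnertonDyer.BirchSwinnertonDyer.Theorems.UniversalToricDescentRelaxedDualTransfer
import Summits.BirchSwinnertonDyer.BirchSwinnertonDyer.Theorems.UniversalToricDescentTwoSidedLayerCountPT
import Summits.BirchSwinnertonDyer.BirchSwinnertonDyer.Theorems.UniversalToricDescentSelmerTorsionOverComap
import Literature.NumberTheory.EllipticCurves.SubgroupSelmerComplexPlacesProofs
import HarnessLib

/-!
# The `Φ^M`-transport of the two-sided layer count: Selmer group and strict quotients (residual level)

Support file for crux `stmt-BirchSwinnertonDyer-24737` (`TwinAlgMuZeroAtThree`, line `beta-road` v5, port stub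
`stub_residualLinkMult`). The assembly `…ResidualLinkOfLayerCount.residual_finite_of_twoSidedLayerCount` wants, for every
layer `U = Γ_n` of the anticyclotomic tower, a `Γ_K`-world count
`#R(U) · #(S ⧸ S ∩ Z_𝔭) · #(S ⧸ S ∩ Z_𝔭′) ≤ #S · p^{pⁿ+c}` with `S = Sel_p(E/K̄^U) ⊂ H¹(U, E[p])`
(`selmerTorsionOver U p`) and `Z_𝔮 = ⋂_σ conj_σ⁻¹ ker (H¹(U, E[p]) → H¹(U ∩ D_𝔮, E[p]))`; the field-world Poitou–Tate count
(`…RelaxedStrictMixedCount`, `…TwoSidedLayerCountPT`) lives in `H¹(Γ_L, E_L[p])`, `L = K̄^U`. This file transports the two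
Selmer-type factors along an abstract Shapiro isomorphism `Φ^M : H¹(Γ_L, E_L[p]) ≃ H¹(U, E[p])` given together with its vanishing
dictionary (`hdict`) and Kummer dictionary (`hkum`) — exactly the package produced by
`…RelaxedLayerTransportTorsionPrimary.exists_transportTorsion_primary` at `k = 1` — for `K` and `L` totally complex:

* §1 the membership dictionaries with empty exceptional set: `z ∈ KS_L(∞)` iff `conj_σ (Φ z)` is classical at every finite `u`
  (all `σ`); adding the strict places over `v` adds exactly `conj_σ (Φ^M z) ∈ awayKer U E[p] v`;
* §2 `(Φ^M)⁻¹` maps `S` into `KS_L(∞)` with `S ∩ Z_𝔮 = (Φ^M)(KS_L(∞ ∪ P_𝔮))`, whence `S` is finite,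
  `#KO_L(∞) ≤ #S` (`natCard_kummerRelaxed_inl_le_selmerTorsionOver`) and
  `#(S ⧸ S ∩ Z_𝔮) ≤ #(KS_L(∞) ⧸ KS_L(∞ ∪ P_𝔮))` (`natCard_selmerTorsionOver_quotient_le`).

References: Greenberg, LNM 1716 (1999), §2 pp. 62–63 and §3 (Shapiro transport of Selmer conditions);
Milne, *Arithmetic Duality Theorems*, I §6 (finiteness of `H¹(G_S, E[m])`, Lemma 6.15).
-/

set_option linter.dupNamespace false
set_option autoImplicit false

noncomputable section
open scoped Classical
open CategoryTheory Field NumberField IsDedekindDomain Function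
open Literature.NumberTheory.EllipticCurves Literature.NumberTheory.EllipticCurves.GreenbergSelmer
open Literature.NumberTheory.GaloisRepresentations
open Literature.NumberTheory.GaloisRepresentations.DiscreteGaloisModule (SelmerStructure)
open Literature.NumberTheory.GaloisCohomology
open scoped ContRepresentation
open scoped NumberField.LiesOver

namespace Summit.BirchSwinnertonDyer.BirchSwinnertonDyer.Theorems.UniversalToricDescentResidualLinkTransport

open Summit.BirchSwinnertonDyer.Rank1Residual.X11b.KummerPT Summit.BirchSwinnertonDyer.Rank1Residual.X11b.LocBridge
open Summit.BirchSwinnertonDyer.Rank1Residual.X11b.SelmerLevelBound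
open Summit.BirchSwinnertonDyer.BirchSwinnertonDyer.Theorems.UniversalToricDescentRelaxedDualTransfer
open Summit.BirchSwinnertonDyer.BirchSwinnertonDyer.Theorems.UniversalToricDescentTwoSidedLayerCountPT
open Summit.BirchSwinnertonDyer.BirchSwinnertonDyer.Theorems.UniversalToricDescentSelmerTorsionOverComap

/-! ## §0. A counting lemma -/

/-- **`#(X ⧸ f⁻¹ B) ≤ #(Y ⧸ B)`**: the map induced by `f` on the quotients is injective. [folklore] -/
theorem natCard_quotient_comap_le {X Y : Type*} [AddCommGroup X] [AddCommGroup Y] (f : X →+ Y) (B : AddSubgroup Y)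
    [Finite (Y ⧸ B)] : Nat.card (X ⧸ B.comap f) ≤ Nat.card (Y ⧸ B) := by
  let g : X ⧸ B.comap f →+ Y ⧸ B := QuotientAddGroup.map (B.comap f) B f le_rfl
  have hg : Function.Injective g := by
    rw [injective_iff_map_eq_zero]
    intro x hx
    obtain ⟨b, rfl⟩ := QuotientAddGroup.mk'_surjective _ x
    rw [QuotientAddGroup.mk'_apply, QuotientAddGroup.eq_zero_iff, AddSubgroup.mem_comap]
    have hx' : (QuotientAddGroup.mk' B) (f b) = 0 := hx
    rw [QuotientAddGroup.mk'_apply, QuotientAddGroup.eq_zero_iff] at hx'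
    exact hx'
  exact Nat.card_le_card_of_injective g hg

variable {K : Type} [Field K] [NumberField K] (W : WeierstrassCurve K) [W.IsElliptic] (p : ℕ) [hp : Fact p.Prime]
  (L : Type) [Field L] [NumberField L] [Algebra K L]
  (U : Subgroup (absoluteGaloisGroup K)) [U.Normal]
  (ΦM : galoisCohomology ((W.baseChange L).torsionGaloisModule ((p : ℕ) : ℤ)) 1 →+ subgroupH1 U (W.geomTorsion ((p : ℕ) : ℤ)))
  (Φ : galoisCohomology ((W.baseChange L).torsionGaloisModule ((p : ℕ) : ℤ)) 1 →+ W.subgroupH1 p U)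
  (hΦ : ∀ z, Φ z = W.torsionToPrimaryH1Sub p U (ΦM z)) (hbij : Function.Bijective ΦM)
  (hdict : ∀ (u : HeightOneSpectrum (𝓞 K)) (z : galoisCohomology ((W.baseChange L).torsionGaloisModule ((p : ℕ) : ℤ)) 1),
    (∀ w : HeightOneSpectrum (𝓞 L), w.asIdeal.LiesOver u.asIdeal →
      galoisCohomology.localization ((W.baseChange L).torsionGaloisModule ((p : ℕ) : ℤ)) (Sum.inr w) 1 z = 0) ↔
    ∀ σ : absoluteGaloisGroup K,
      conjH1 U (W.geomTorsion ((p : ℕ) : ℤ)) σ (ΦM z) ∈ awayKer U (W.geomTorsion ((p : ℕ) : ℤ)) u)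
  (hkum : ∀ (u : HeightOneSpectrum (𝓞 K)) (x : galoisCohomology ((W.baseChange L).torsionGaloisModule ((p : ℕ) : ℤ)) 1),
    (∀ w : HeightOneSpectrum (𝓞 L), w.asIdeal.LiesOver u.asIdeal →
      galoisCohomology.res ((W.baseChange L).torsionGaloisModule ((p : ℕ) : ℤ)) (w.adicCompletion L) 1 x ∈
        (W.baseChange L).kummerLocalConditionAt ((p : ℕ) : ℤ) (w.adicCompletion L)) ↔
    ∀ σ : absoluteGaloisGroup K, W.conjH1 p U σ (Φ x) ∈ W.localKerOver p U (u.adicCompletion K))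
  (hL : ∀ w : InfinitePlace L, w.IsComplex) (hK : ∀ w : InfinitePlace K, w.IsComplex)

/-! ## §1. The membership dictionaries with empty exceptional set -/

include hkum in
omit [W.IsElliptic] hp in
/-- `y ∈ KS_L(∞)` ⟹ `conj_σ (Φ y)` is classical at every finite place `u` of `K` (all `σ`).
[cite: GreenbergLNM1716, §2 (pp. 62–63)] -/
theorem localKerOver_of_mem_kummerStrict_inl {y : galoisCohomology ((W.baseChange L).torsionGaloisModule ((p : ℕ) : ℤ)) 1}
    (hy : y ∈ (kummerStrict (W.baseChange L) p (Finset.univ.image Sum.inl)).selmerGroup)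
    (u : HeightOneSpectrum (𝓞 K)) (σ : absoluteGaloisGroup K) :
    W.conjH1 p U σ (Φ y) ∈ W.localKerOver p U (u.adicCompletion K) := by
  rw [SelmerStructure.mem_selmerGroup_iff] at hy
  refine (hkum u y).mp (fun w _ ↦ ?_) σ
  have hnot : (Sum.inr w : Place L) ∉ (Finset.univ.image Sum.inl : Finset (Place L)) := by simp [Finset.mem_image]
  have h := hy (Sum.inr w)
  rw [kummerStrict_of_not_mem _ _ _ hnot] at h
  exact h

include hkum hL in
omit [W.IsElliptic] hp in
/-- `conj_σ (Φ z)` classical at every finite `u` (all `σ`) ⟹ `z ∈ KS_L(∞)` (`L` totally complex: the strict condition at the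
infinite places is empty, `H¹(L_w, ·) = 0`). [cite: GreenbergLNM1716, §2 (pp. 62–63), §3 p. 87] -/
theorem mem_kummerStrict_inl_of_localKerOver {z : galoisCohomology ((W.baseChange L).torsionGaloisModule ((p : ℕ) : ℤ)) 1}
    (h1 : ∀ (u : HeightOneSpectrum (𝓞 K)) (σ : absoluteGaloisGroup K),
      W.conjH1 p U σ (Φ z) ∈ W.localKerOver p U (u.adicCompletion K)) :
    z ∈ (kummerStrict (W.baseChange L) p (Finset.univ.image Sum.inl)).selmerGroup := by
  rw [SelmerStructure.mem_selmerGroup_iff]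
  rintro (w | w)
  · have hmem : (Sum.inl w : Place L) ∈ (Finset.univ.image Sum.inl : Finset (Place L)) := by simp
    rw [kummerStrict_of_mem _ _ _ hmem, localization_inl_eq_zero_of_isComplex _ (hL w)]
    exact AddSubgroup.zero_mem _
  · have hnot : (Sum.inr w : Place L) ∉ (Finset.univ.image Sum.inl : Finset (Place L)) := by simp [Finset.mem_image]
    rw [kummerStrict_of_not_mem _ _ _ hnot]
    exact (hkum (w.under (𝓞 K)) z).mpr (h1 _) w (Literature.NumberTheory.GaloisRepresentations.liesOver_under w)

include hdict in
omit [W.IsElliptic] hp in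
/-- **Adding the strict places over `v` adds exactly local triviality at `v`**: for the place set `V_L` of `L` over `v`,
`z ∈ KS_L(∞ ∪ V_L)` iff `z ∈ KS_L(∞)` and `conj_σ (Φ^M z) ∈ awayKer U E[p] v` for all `σ`.
[cite: GreenbergLNM1716, §2 (pp. 62–63)] [cite: Howard2004HeegnerKolyvagin, Def. 2.1.1] -/
theorem mem_kummerStrict_inl_union_iff {v : HeightOneSpectrum (𝓞 K)}
    (VL : Finset (HeightOneSpectrum (𝓞 L))) (hVL : ∀ w, w ∈ VL ↔ w.under (𝓞 K) = v)
    (z : galoisCohomology ((W.baseChange L).torsionGaloisModule ((p : ℕ) : ℤ)) 1) :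
    z ∈ (kummerStrict (W.baseChange L) p (Finset.univ.image Sum.inl ∪ VL.image Sum.inr)).selmerGroup ↔
      z ∈ (kummerStrict (W.baseChange L) p (Finset.univ.image Sum.inl)).selmerGroup ∧
        ∀ σ : absoluteGaloisGroup K,
          conjH1 U (W.geomTorsion ((p : ℕ) : ℤ)) σ (ΦM z) ∈ awayKer U (W.geomTorsion ((p : ℕ) : ℤ)) v := by
  have hinr : ∀ w : HeightOneSpectrum (𝓞 L),
      (Sum.inr w : Place L) ∈ (Finset.univ.image Sum.inl ∪ VL.image Sum.inr : Finset (Place L)) ↔ w.under (𝓞 K) = v := by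
    intro w
    rw [← hVL]
    simp [Finset.mem_image]
  have hinl : ∀ w : InfinitePlace L,
      (Sum.inl w : Place L) ∈ (Finset.univ.image Sum.inl ∪ VL.image Sum.inr : Finset (Place L)) := fun w ↦ by
    simp [Finset.mem_image]
  have hinl₀ : ∀ w : InfinitePlace L, (Sum.inl w : Place L) ∈ (Finset.univ.image Sum.inl : Finset (Place L)) :=
    fun w ↦ by simp
  have hinr₀ : ∀ w : HeightOneSpectrum (𝓞 L), (Sum.inr w : Place L) ∉ (Finset.univ.image Sum.inl : Finset (Place L)) :=
    fun w ↦ by simp [Finset.mem_image]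
  rw [SelmerStructure.mem_selmerGroup_iff, SelmerStructure.mem_selmerGroup_iff, ← hdict v z]
  constructor
  · intro h
    refine ⟨?_, fun w hw ↦ ?_⟩
    · rintro (w | w)
      · have h' := h (Sum.inl w)
        rw [kummerStrict_of_mem _ _ _ (hinl w)] at h'
        rw [kummerStrict_of_mem _ _ _ (hinl₀ w)]
        exact h'
      · rw [kummerStrict_of_not_mem _ _ _ (hinr₀ w)]
        by_cases hwv : w.under (𝓞 K) = v
        · have h' := h (Sum.inr w)
          rw [kummerStrict_of_mem _ _ _ ((hinr w).mpr hwv), AddSubgroup.mem_bot] at h'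
          rw [h']
          exact AddSubgroup.zero_mem _
        · have h' := h (Sum.inr w)
          rw [kummerStrict_of_not_mem _ _ _ (fun h'' ↦ hwv ((hinr w).mp h''))] at h'
          exact h'
    · have h' := h (Sum.inr w)
      rw [kummerStrict_of_mem _ _ _ ((hinr w).mpr ((liesOver_iff_under_eq w v).mp hw)), AddSubgroup.mem_bot] at h'
      exact h'
  · rintro ⟨h, hV⟩ (w | w)
    · rw [kummerStrict_of_mem _ _ _ (hinl w)]
      have h' := h (Sum.inl w)
      rw [kummerStrict_of_mem _ _ _ (hinl₀ w)] at h'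
      exact h'
    · by_cases hwv : w.under (𝓞 K) = v
      · rw [kummerStrict_of_mem _ _ _ ((hinr w).mpr hwv), AddSubgroup.mem_bot]
        exact hV w ((liesOver_iff_under_eq w v).mpr hwv)
      · rw [kummerStrict_of_not_mem _ _ _ (fun h' ↦ hwv ((hinr w).mp h'))]
        have h' := h (Sum.inr w)
        rw [kummerStrict_of_not_mem _ _ _ (hinr₀ w)] at h'
        exact h'

/-! ## §2. Transport of the Selmer group and of the strict quotients -/

omit [NumberField K] [W.IsElliptic] hp [NumberField L] [U.Normal] in
/-- `Φ^M ∘ (Φ^M)⁻¹ = id`. [folklore] -/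
theorem apply_ofBijective_symm (y : subgroupH1 U (W.geomTorsion ((p : ℕ) : ℤ))) :
    ΦM ((AddEquiv.ofBijective ΦM hbij).symm y) = y := by
  rw [← AddEquiv.ofBijective_apply ΦM hbij]
  exact AddEquiv.apply_symm_apply _ y

include hΦ hkum hL in
omit [W.IsElliptic] hp in
/-- **`(Φ^M)⁻¹` maps `Sel_p(E/K̄^U) ⊂ H¹(U, E[p])` into `KS_L(∞)`**: a class of `S = selmerTorsionOver U p` has
`conj_σ (ι x)` classical at every finite place (`selmerTorsionOver = ι⁻¹ Sel_{p^∞}`), hence its `Φ^M`-preimage is Kummer at every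
finite place of `L` (`hkum`). [cite: GreenbergLNM1716, §2 (pp. 62–63)] -/
theorem ofBijective_symm_mem_kummerStrict_inl {x : subgroupH1 U (W.geomTorsion ((p : ℕ) : ℤ))}
    (hx : x ∈ W.selmerTorsionOver U (p : ℤ)) :
    (AddEquiv.ofBijective ΦM hbij).symm x ∈ (kummerStrict (W.baseChange L) p (Finset.univ.image Sum.inl)).selmerGroup := by
  have hx' : W.torsionToPrimaryH1Sub p U x ∈ W.selmerGroupOver p U := by
    rw [selmerTorsionOver_eq_comap_selmerGroupOver W p U] at hx
    exact hx
  rw [WeierstrassCurve.mem_selmerGroupOver_iff] at hx'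
  have h1 := hx'.1
  refine mem_kummerStrict_inl_of_localKerOver W p L U Φ hkum hL fun u σ ↦ ?_
  rw [hΦ, apply_ofBijective_symm W p L U ΦM hbij x]
  exact h1 u σ

include hΦ hbij hkum hL in
/-- **`Sel_p(E/K̄^U) ⊂ H¹(U, E[p])` is finite**: it embeds by `(Φ^M)⁻¹` into `KS_L(∞) ≤ KO_L(∞)`, which is finite
(Milne I Lemma 6.15, tree `finite_kummerOutside`). [cite: MilneADT2006, Ch. I, Lemma 6.15] -/
theorem finite_selmerTorsionOver : Finite ↥(W.selmerTorsionOver U (p : ℤ)) := by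
  haveI : NeZero p := ⟨hp.out.ne_zero⟩
  haveI : Finite ↥(kummerRelaxed (W.baseChange L) p (Finset.univ.image Sum.inl)).selmerGroup := by
    rw [selmerGroup_kummerRelaxed]; exact finite_kummerOutside _ _ _
  have hle : (kummerStrict (W.baseChange L) p (Finset.univ.image Sum.inl)).selmerGroup ≤
      (kummerRelaxed (W.baseChange L) p (Finset.univ.image Sum.inl)).selmerGroup :=
    selmerGroup_mono' (W.baseChange L) p (kummerStrict_le_kummerRelaxed' (W.baseChange L) p _ _)
  let f : ↥(W.selmerTorsionOver U (p : ℤ)) → ↥(kummerRelaxed (W.baseChange L) p (Finset.univ.image Sum.inl)).selmerGroup :=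
    fun x ↦ ⟨(AddEquiv.ofBijective ΦM hbij).symm x,
      hle (ofBijective_symm_mem_kummerStrict_inl W p L U ΦM Φ hΦ hbij hkum hL x.2)⟩
  refine Finite.of_injective f fun x y hxy ↦ ?_
  have h : (AddEquiv.ofBijective ΦM hbij).symm x = (AddEquiv.ofBijective ΦM hbij).symm y := congrArg Subtype.val hxy
  exact Subtype.ext ((AddEquiv.ofBijective ΦM hbij).symm.injective h)

include hΦ hkum hK in
omit [W.IsElliptic] hp in
/-- **`Φ^M` maps `KS_L(∞)` into `Sel_p(E/K̄^U)`** (`K` totally complex: the archimedean conditions of `Sel_{p^∞}` are vacuous).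
[cite: GreenbergLNM1716, §2 (pp. 62–63), §3 p. 87] -/
theorem apply_mem_selmerTorsionOver {y : galoisCohomology ((W.baseChange L).torsionGaloisModule ((p : ℕ) : ℤ)) 1}
    (hy : y ∈ (kummerStrict (W.baseChange L) p (Finset.univ.image Sum.inl)).selmerGroup) :
    ΦM y ∈ W.selmerTorsionOver U (p : ℤ) := by
  rw [selmerTorsionOver_eq_comap_selmerGroupOver W p U, AddSubgroup.mem_comap, WeierstrassCurve.mem_selmerGroupOver_iff]
  refine ⟨fun u σ ↦ ?_, fun w σ ↦ ?_⟩
  · rw [← hΦ]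
    exact localKerOver_of_mem_kummerStrict_inl W p L U Φ hkum hy u σ
  · rw [WeierstrassCurve.localKerOver_completion_eq_top_of_isComplex W p U (hK w)]
    exact AddSubgroup.mem_top _

include hΦ hbij hkum hL hK in
/-- **(T1) `#KO_L(∞) ≤ #Sel_p(E/K̄^U)`**: for `L` totally complex `KO_L(∞) = KS_L(∞)` (nothing happens at complex places), and
`Φ^M` embeds `KS_L(∞)` into `S`. [cite: GreenbergLNM1716, §2 (pp. 62–63), §3 p. 87] -/
theorem natCard_kummerRelaxed_inl_le_selmerTorsionOver :
    Nat.card ↥(kummerRelaxed (W.baseChange L) p (Finset.univ.image Sum.inl)).selmerGroup ≤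
      Nat.card ↥(W.selmerTorsionOver U (p : ℤ)) := by
  haveI := finite_selmerTorsionOver W p L U ΦM Φ hΦ hbij hkum hL
  -- `KO_L(∞) ≤ KS_L(∞)` for `L` totally complex
  have hle : (kummerRelaxed (W.baseChange L) p (Finset.univ.image Sum.inl)).selmerGroup ≤
      (kummerStrict (W.baseChange L) p (Finset.univ.image Sum.inl)).selmerGroup := by
    intro c hc
    rw [SelmerStructure.mem_selmerGroup_iff] at hc ⊢
    rintro (w | w)
    · have hmem : (Sum.inl w : Place L) ∈ (Finset.univ.image Sum.inl : Finset (Place L)) := by simp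
      rw [kummerStrict_of_mem _ _ _ hmem, localization_inl_eq_zero_of_isComplex _ (hL w)]
      exact AddSubgroup.zero_mem _
    · have hnot : (Sum.inr w : Place L) ∉ (Finset.univ.image Sum.inl : Finset (Place L)) := by simp [Finset.mem_image]
      have h := hc (Sum.inr w)
      rw [kummerRelaxed_of_not_mem _ _ _ hnot] at h
      rw [kummerStrict_of_not_mem _ _ _ hnot]
      exact h
  let f : ↥(kummerRelaxed (W.baseChange L) p (Finset.univ.image Sum.inl)).selmerGroup → ↥(W.selmerTorsionOver U (p : ℤ)) :=
    fun y ↦ ⟨ΦM y, apply_mem_selmerTorsionOver W p L U ΦM Φ hΦ hkum hK (hle y.2)⟩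
  refine Nat.card_le_card_of_injective f fun x y hxy ↦ ?_
  exact Subtype.ext (hbij.1 (congrArg Subtype.val hxy))

include hΦ hbij hdict hkum hL in
/-- **(T2) `#(S ⧸ S ∩ Z_𝔮) ≤ #(KS_L(∞) ⧸ KS_L(∞ ∪ P_𝔮))`** for `S = Sel_p(E/K̄^U)`,
`Z_𝔮 = ⋂_σ conj_σ⁻¹ ker(H¹(U, E[p]) → H¹(U ∩ D_𝔮, E[p]))` and `P_𝔮` the places of `L` over `𝔮`: `(Φ^M)⁻¹` maps `S` into
`KS_L(∞)` and pulls `KS_L(∞ ∪ P_𝔮)` back to exactly `S ∩ Z_𝔮` (vanishing dictionary), so it induces an injection of the quotients.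
[cite: GreenbergLNM1716, §2 (pp. 62–63)] [cite: Howard2004HeegnerKolyvagin, Def. 2.1.1] -/
theorem natCard_selmerTorsionOver_quotient_le (v : HeightOneSpectrum (𝓞 K))
    (VL : Finset (HeightOneSpectrum (𝓞 L))) (hVL : ∀ w, w ∈ VL ↔ w.under (𝓞 K) = v) :
    Nat.card (↥(W.selmerTorsionOver U (p : ℤ)) ⧸
        (⨅ σ : absoluteGaloisGroup K,
          (AddMonoidHom.ker (resOfLe (↥(W.geomTorsion (p : ℤ))) (inf_le_left : U ⊓ decomp v ≤ U))).comap
            (conjH1 U (↥(W.geomTorsion (p : ℤ))) σ)).addSubgroupOf (W.selmerTorsionOver U (p : ℤ))) ≤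
      Nat.card (↥(kummerStrict (W.baseChange L) p (Finset.univ.image Sum.inl)).selmerGroup ⧸
        ((kummerStrict (W.baseChange L) p (Finset.univ.image Sum.inl ∪ VL.image Sum.inr)).selmerGroup).addSubgroupOf
          (kummerStrict (W.baseChange L) p (Finset.univ.image Sum.inl)).selmerGroup) := by
  haveI : NeZero p := ⟨hp.out.ne_zero⟩
  haveI : Finite ↥(kummerRelaxed (W.baseChange L) p (Finset.univ.image Sum.inl)).selmerGroup := by
    rw [selmerGroup_kummerRelaxed]; exact finite_kummerOutside _ _ _
  haveI : Finite ↥(kummerStrict (W.baseChange L) p (Finset.univ.image Sum.inl)).selmerGroup :=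
    Finite.of_injective _ (AddSubgroup.inclusion_injective
      (selmerGroup_mono' (W.baseChange L) p (kummerStrict_le_kummerRelaxed' (W.baseChange L) p
        (Finset.univ.image Sum.inl) (Finset.univ.image Sum.inl))))
  set S := W.selmerTorsionOver U (p : ℤ) with hS
  set KS₀ := (kummerStrict (W.baseChange L) p (Finset.univ.image Sum.inl)).selmerGroup with hKS₀
  set KSV := (kummerStrict (W.baseChange L) p (Finset.univ.image Sum.inl ∪ VL.image Sum.inr)).selmerGroup with hKSV
  -- the map `x ↦ (Φ^M)⁻¹ x : S → KS_L(∞)`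
  let e := AddEquiv.ofBijective ΦM hbij
  have hmem : ∀ x : ↥S, (e.symm.toAddMonoidHom.comp S.subtype) x ∈ KS₀ := fun x ↦
    ofBijective_symm_mem_kummerStrict_inl W p L U ΦM Φ hΦ hbij hkum hL x.2
  let f : ↥S →+ ↥KS₀ := AddMonoidHom.codRestrict (e.symm.toAddMonoidHom.comp S.subtype) KS₀ hmem
  have hf : ∀ x : ↥S, ((f x : ↥KS₀) : galoisCohomology _ 1) = e.symm x := fun _ ↦ rfl
  -- `f⁻¹ (KS_L(∞ ∪ P_𝔮)) = S ∩ Z_𝔮`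
  have hker : (KSV.addSubgroupOf KS₀).comap f =
      (⨅ σ : absoluteGaloisGroup K,
        (AddMonoidHom.ker (resOfLe (↥(W.geomTorsion (p : ℤ))) (inf_le_left : U ⊓ decomp v ≤ U))).comap
          (conjH1 U (↥(W.geomTorsion (p : ℤ))) σ)).addSubgroupOf S := by
    ext x
    rw [AddSubgroup.mem_comap, AddSubgroup.mem_addSubgroupOf, AddSubgroup.mem_addSubgroupOf, hf, hKSV,
      mem_kummerStrict_inl_union_iff W p L U ΦM hdict VL hVL, AddSubgroup.mem_iInf]
    constructor
    · rintro ⟨-, h⟩ σ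
      rw [AddSubgroup.mem_comap, AddMonoidHom.mem_ker]
      have h' := h σ
      rw [apply_ofBijective_symm W p L U ΦM hbij] at h'
      exact h'
    · intro h
      refine ⟨hmem x, fun σ ↦ ?_⟩
      rw [apply_ofBijective_symm W p L U ΦM hbij]
      have h' := h σ
      rw [AddSubgroup.mem_comap, AddMonoidHom.mem_ker] at h'
      exact h'
  rw [← hker]
  exact natCard_quotient_comap_le f (KSV.addSubgroupOf KS₀)

end Summit.BirchSwinnertonDyer.BirchSwinnertonDyer.Theorems.UniversalToricDescentResidualLinkTransport

end
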